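import Literature.NumberTheory.EllipticCurves.Curve5077aPointCounts
import Literature.NumberTheory.EllipticCurves.Curve5077aRootNumber
import Literature.NumberTheory.EllipticCurves.ModularityVersionApProofs
import HarnessLib

/-!
# The curve 5077a: the Dirichlet coefficients `aₙ(E)` for all `n ≤ 64`

Continuation of `Curve5077aPointCounts.lean` (`a_p`, `p ≤ 61` prime): the coefficients of
`L(E, s) = ∑ aₙ n⁻ˢ` (Mathlib's `WeierstrassCurve.LFunction`) for `E = Curve5077a.E` at prime powers
by `a_{p^{k+2}} = a_p a_{p^{k+1}} − p a_{p^k}` for `p ∤ N_E = 5077` (tree theorem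
`WeierstrassCurve.LFunction_apply_prime_pow_add_two_of_prime`, Diamond–Shurman (8.44), with
`conductorNorm_E = 5077`) and at composite `n` by multiplicativity
(`WeierstrassCurve.isMultiplicative_LFunction`), as closed integer equalities
`Curve5077a.LFunction_E_n : E.LFunction n = aₙ`, `n ≤ 64`. Purpose: the finite part of the
Buhler–Gross–Zagier series for `Λ‴(E, 1)` (§3–4 of their paper). Everything is PROVED; no `def`.

## References
* J. P. Buhler, B. H. Gross, D. B. Zagier, *On the conjecture of Birch and Swinnerton-Dyer for an
  elliptic curve of rank 3*, Math. Comp. 44 (1985) 473–481, §3 (p. 478). [BuhlerGrossZagier1985]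
* J. E. Cremona, *Algorithms for Modular Elliptic Curves*, 2nd ed. (1997), Table 3 (curve 5077a).
  [CremonaAlgorithms1997]
* J. H. Silverman, *The Arithmetic of Elliptic Curves*, 2nd ed. (2009), Ex. 8.19(a). [SilvermanAEC2009]
-/

namespace Literature.NumberTheory.EllipticCurves.Curve5077a

open WeierstrassCurve

/-- `a_4(5077a) = 2` (`4 = 2^2`, `a_{p^(k+2)} = a_p a_{p^(k+1)} − p a_{p^k}`). [cite: CremonaAlgorithms1997, Table 3 (5077a)] -/
theorem LFunction_E_4 : E.LFunction 4 = 2 := by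
  rw [show (4 : ℕ) = 2 ^ (0 + 2) by norm_num,
    E.LFunction_apply_prime_pow_add_two_of_prime (by norm_num : Nat.Prime 2) 0, conductorNorm_E,
    show (2 : ℕ) ^ (0 + 1) = 2 by norm_num, show (2 : ℕ) ^ 0 = 1 by norm_num]
  simp only [LFunction_E_2, LFunction_E_2, LFunction_E_1]
  norm_num

/-- `a_6(5077a) = 6` (`6 = 2·3`, multiplicativity). [cite: CremonaAlgorithms1997, Table 3 (5077a)] -/
theorem LFunction_E_6 : E.LFunction 6 = 6 := by
  rw [show (6 : ℕ) = 2 * 3 by norm_num,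
    E.isMultiplicative_LFunction.map_mul_of_coprime (by norm_num), LFunction_E_2, LFunction_E_3]
  norm_num

/-- `a_8(5077a) = 0` (`8 = 2^3`, `a_{p^(k+2)} = a_p a_{p^(k+1)} − p a_{p^k}`). [cite: CremonaAlgorithms1997, Table 3 (5077a)] -/
theorem LFunction_E_8 : E.LFunction 8 = 0 := by
  rw [show (8 : ℕ) = 2 ^ (1 + 2) by norm_num,
    E.LFunction_apply_prime_pow_add_two_of_prime (by norm_num : Nat.Prime 2) 1, conductorNorm_E,
    show (2 : ℕ) ^ (1 + 1) = 4 by norm_num, show (2 : ℕ) ^ 1 = 2 by norm_num]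
  simp only [LFunction_E_2, LFunction_E_4, LFunction_E_2]
  norm_num

/-- `a_9(5077a) = 6` (`9 = 3^2`, `a_{p^(k+2)} = a_p a_{p^(k+1)} − p a_{p^k}`). [cite: CremonaAlgorithms1997, Table 3 (5077a)] -/
theorem LFunction_E_9 : E.LFunction 9 = 6 := by
  rw [show (9 : ℕ) = 3 ^ (0 + 2) by norm_num,
    E.LFunction_apply_prime_pow_add_two_of_prime (by norm_num : Nat.Prime 3) 0, conductorNorm_E,
    show (3 : ℕ) ^ (0 + 1) = 3 by norm_num, show (3 : ℕ) ^ 0 = 1 by norm_num]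
  simp only [LFunction_E_3, LFunction_E_3, LFunction_E_1]
  norm_num

/-- `a_10(5077a) = 8` (`10 = 2·5`, multiplicativity). [cite: CremonaAlgorithms1997, Table 3 (5077a)] -/
theorem LFunction_E_10 : E.LFunction 10 = 8 := by
  rw [show (10 : ℕ) = 2 * 5 by norm_num,
    E.isMultiplicative_LFunction.map_mul_of_coprime (by norm_num), LFunction_E_2, LFunction_E_5]
  norm_num

/-- `a_12(5077a) = -6` (`12 = 4·3`, multiplicativity). [cite: CremonaAlgorithms1997, Table 3 (5077a)] -/
theorem LFunction_E_12 : E.LFunction 12 = -6 := by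
  rw [show (12 : ℕ) = 4 * 3 by norm_num,
    E.isMultiplicative_LFunction.map_mul_of_coprime (by norm_num), LFunction_E_4, LFunction_E_3]
  norm_num

/-- `a_14(5077a) = 8` (`14 = 2·7`, multiplicativity). [cite: CremonaAlgorithms1997, Table 3 (5077a)] -/
theorem LFunction_E_14 : E.LFunction 14 = 8 := by
  rw [show (14 : ℕ) = 2 * 7 by norm_num,
    E.isMultiplicative_LFunction.map_mul_of_coprime (by norm_num), LFunction_E_2, LFunction_E_7]
  norm_num

/-- `a_15(5077a) = 12` (`15 = 3·5`, multiplicativity). [cite: CremonaAlgorithms1997, Table 3 (5077a)] -/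
theorem LFunction_E_15 : E.LFunction 15 = 12 := by
  rw [show (15 : ℕ) = 3 * 5 by norm_num,
    E.isMultiplicative_LFunction.map_mul_of_coprime (by norm_num), LFunction_E_3, LFunction_E_5]
  norm_num

/-- `a_16(5077a) = -4` (`16 = 2^4`, `a_{p^(k+2)} = a_p a_{p^(k+1)} − p a_{p^k}`). [cite: CremonaAlgorithms1997, Table 3 (5077a)] -/
theorem LFunction_E_16 : E.LFunction 16 = -4 := by
  rw [show (16 : ℕ) = 2 ^ (2 + 2) by norm_num,
    E.LFunction_apply_prime_pow_add_two_of_prime (by norm_num : Nat.Prime 2) 2, conductorNorm_E,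
    show (2 : ℕ) ^ (2 + 1) = 8 by norm_num, show (2 : ℕ) ^ 2 = 4 by norm_num]
  simp only [LFunction_E_2, LFunction_E_8, LFunction_E_4]
  norm_num

/-- `a_18(5077a) = -12` (`18 = 2·9`, multiplicativity). [cite: CremonaAlgorithms1997, Table 3 (5077a)] -/
theorem LFunction_E_18 : E.LFunction 18 = -12 := by
  rw [show (18 : ℕ) = 2 * 9 by norm_num,
    E.isMultiplicative_LFunction.map_mul_of_coprime (by norm_num), LFunction_E_2, LFunction_E_9]
  norm_num

/-- `a_20(5077a) = -8` (`20 = 4·5`, multiplicativity). [cite: CremonaAlgorithms1997, Table 3 (5077a)] -/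
theorem LFunction_E_20 : E.LFunction 20 = -8 := by
  rw [show (20 : ℕ) = 4 * 5 by norm_num,
    E.isMultiplicative_LFunction.map_mul_of_coprime (by norm_num), LFunction_E_4, LFunction_E_5]
  norm_num

/-- `a_21(5077a) = 12` (`21 = 3·7`, multiplicativity). [cite: CremonaAlgorithms1997, Table 3 (5077a)] -/
theorem LFunction_E_21 : E.LFunction 21 = 12 := by
  rw [show (21 : ℕ) = 3 * 7 by norm_num,
    E.isMultiplicative_LFunction.map_mul_of_coprime (by norm_num), LFunction_E_3, LFunction_E_7]
  norm_num

/-- `a_22(5077a) = 12` (`22 = 2·11`, multiplicativity). [cite: CremonaAlgorithms1997, Table 3 (5077a)] -/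
theorem LFunction_E_22 : E.LFunction 22 = 12 := by
  rw [show (22 : ℕ) = 2 * 11 by norm_num,
    E.isMultiplicative_LFunction.map_mul_of_coprime (by norm_num), LFunction_E_2, LFunction_E_11]
  norm_num

/-- `a_24(5077a) = 0` (`24 = 8·3`, multiplicativity). [cite: CremonaAlgorithms1997, Table 3 (5077a)] -/
theorem LFunction_E_24 : E.LFunction 24 = 0 := by
  rw [show (24 : ℕ) = 8 * 3 by norm_num,
    E.isMultiplicative_LFunction.map_mul_of_coprime (by norm_num), LFunction_E_8, LFunction_E_3]
  norm_num

/-- `a_25(5077a) = 11` (`25 = 5^2`, `a_{p^(k+2)} = a_p a_{p^(k+1)} − p a_{p^k}`). [cite: CremonaAlgorithms1997, Table 3 (5077a)] -/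
theorem LFunction_E_25 : E.LFunction 25 = 11 := by
  rw [show (25 : ℕ) = 5 ^ (0 + 2) by norm_num,
    E.LFunction_apply_prime_pow_add_two_of_prime (by norm_num : Nat.Prime 5) 0, conductorNorm_E,
    show (5 : ℕ) ^ (0 + 1) = 5 by norm_num, show (5 : ℕ) ^ 0 = 1 by norm_num]
  simp only [LFunction_E_5, LFunction_E_5, LFunction_E_1]
  norm_num

/-- `a_26(5077a) = 8` (`26 = 2·13`, multiplicativity). [cite: CremonaAlgorithms1997, Table 3 (5077a)] -/
theorem LFunction_E_26 : E.LFunction 26 = 8 := by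
  rw [show (26 : ℕ) = 2 * 13 by norm_num,
    E.isMultiplicative_LFunction.map_mul_of_coprime (by norm_num), LFunction_E_2, LFunction_E_13]
  norm_num

/-- `a_27(5077a) = -9` (`27 = 3^3`, `a_{p^(k+2)} = a_p a_{p^(k+1)} − p a_{p^k}`). [cite: CremonaAlgorithms1997, Table 3 (5077a)] -/
theorem LFunction_E_27 : E.LFunction 27 = -9 := by
  rw [show (27 : ℕ) = 3 ^ (1 + 2) by norm_num,
    E.LFunction_apply_prime_pow_add_two_of_prime (by norm_num : Nat.Prime 3) 1, conductorNorm_E,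
    show (3 : ℕ) ^ (1 + 1) = 9 by norm_num, show (3 : ℕ) ^ 1 = 3 by norm_num]
  simp only [LFunction_E_3, LFunction_E_9, LFunction_E_3]
  norm_num

/-- `a_28(5077a) = -8` (`28 = 4·7`, multiplicativity). [cite: CremonaAlgorithms1997, Table 3 (5077a)] -/
theorem LFunction_E_28 : E.LFunction 28 = -8 := by
  rw [show (28 : ℕ) = 4 * 7 by norm_num,
    E.isMultiplicative_LFunction.map_mul_of_coprime (by norm_num), LFunction_E_4, LFunction_E_7]
  norm_num

/-- `a_30(5077a) = -24` (`30 = 2·15`, multiplicativity). [cite: CremonaAlgorithms1997, Table 3 (5077a)] -/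
theorem LFunction_E_30 : E.LFunction 30 = -24 := by
  rw [show (30 : ℕ) = 2 * 15 by norm_num,
    E.isMultiplicative_LFunction.map_mul_of_coprime (by norm_num), LFunction_E_2, LFunction_E_15]
  norm_num

/-- `a_32(5077a) = 8` (`32 = 2^5`, `a_{p^(k+2)} = a_p a_{p^(k+1)} − p a_{p^k}`). [cite: CremonaAlgorithms1997, Table 3 (5077a)] -/
theorem LFunction_E_32 : E.LFunction 32 = 8 := by
  rw [show (32 : ℕ) = 2 ^ (3 + 2) by norm_num,
    E.LFunction_apply_prime_pow_add_two_of_prime (by norm_num : Nat.Prime 2) 3, conductorNorm_E,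
    show (2 : ℕ) ^ (3 + 1) = 16 by norm_num, show (2 : ℕ) ^ 3 = 8 by norm_num]
  simp only [LFunction_E_2, LFunction_E_16, LFunction_E_8]
  norm_num

/-- `a_33(5077a) = 18` (`33 = 3·11`, multiplicativity). [cite: CremonaAlgorithms1997, Table 3 (5077a)] -/
theorem LFunction_E_33 : E.LFunction 33 = 18 := by
  rw [show (33 : ℕ) = 3 * 11 by norm_num,
    E.isMultiplicative_LFunction.map_mul_of_coprime (by norm_num), LFunction_E_3, LFunction_E_11]
  norm_num

/-- `a_34(5077a) = 8` (`34 = 2·17`, multiplicativity). [cite: CremonaAlgorithms1997, Table 3 (5077a)] -/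
theorem LFunction_E_34 : E.LFunction 34 = 8 := by
  rw [show (34 : ℕ) = 2 * 17 by norm_num,
    E.isMultiplicative_LFunction.map_mul_of_coprime (by norm_num), LFunction_E_2, LFunction_E_17]
  norm_num

/-- `a_35(5077a) = 16` (`35 = 5·7`, multiplicativity). [cite: CremonaAlgorithms1997, Table 3 (5077a)] -/
theorem LFunction_E_35 : E.LFunction 35 = 16 := by
  rw [show (35 : ℕ) = 5 * 7 by norm_num,
    E.isMultiplicative_LFunction.map_mul_of_coprime (by norm_num), LFunction_E_5, LFunction_E_7]
  norm_num

/-- `a_36(5077a) = 12` (`36 = 4·9`, multiplicativity). [cite: CremonaAlgorithms1997, Table 3 (5077a)] -/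
theorem LFunction_E_36 : E.LFunction 36 = 12 := by
  rw [show (36 : ℕ) = 4 * 9 by norm_num,
    E.isMultiplicative_LFunction.map_mul_of_coprime (by norm_num), LFunction_E_4, LFunction_E_9]
  norm_num

/-- `a_38(5077a) = 14` (`38 = 2·19`, multiplicativity). [cite: CremonaAlgorithms1997, Table 3 (5077a)] -/
theorem LFunction_E_38 : E.LFunction 38 = 14 := by
  rw [show (38 : ℕ) = 2 * 19 by norm_num,
    E.isMultiplicative_LFunction.map_mul_of_coprime (by norm_num), LFunction_E_2, LFunction_E_19]
  norm_num

/-- `a_39(5077a) = 12` (`39 = 3·13`, multiplicativity). [cite: CremonaAlgorithms1997, Table 3 (5077a)] -/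
theorem LFunction_E_39 : E.LFunction 39 = 12 := by
  rw [show (39 : ℕ) = 3 * 13 by norm_num,
    E.isMultiplicative_LFunction.map_mul_of_coprime (by norm_num), LFunction_E_3, LFunction_E_13]
  norm_num

/-- `a_40(5077a) = 0` (`40 = 8·5`, multiplicativity). [cite: CremonaAlgorithms1997, Table 3 (5077a)] -/
theorem LFunction_E_40 : E.LFunction 40 = 0 := by
  rw [show (40 : ℕ) = 8 * 5 by norm_num,
    E.isMultiplicative_LFunction.map_mul_of_coprime (by norm_num), LFunction_E_8, LFunction_E_5]
  norm_num

/-- `a_42(5077a) = -24` (`42 = 2·21`, multiplicativity). [cite: CremonaAlgorithms1997, Table 3 (5077a)] -/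
theorem LFunction_E_42 : E.LFunction 42 = -24 := by
  rw [show (42 : ℕ) = 2 * 21 by norm_num,
    E.isMultiplicative_LFunction.map_mul_of_coprime (by norm_num), LFunction_E_2, LFunction_E_21]
  norm_num

/-- `a_44(5077a) = -12` (`44 = 4·11`, multiplicativity). [cite: CremonaAlgorithms1997, Table 3 (5077a)] -/
theorem LFunction_E_44 : E.LFunction 44 = -12 := by
  rw [show (44 : ℕ) = 4 * 11 by norm_num,
    E.isMultiplicative_LFunction.map_mul_of_coprime (by norm_num), LFunction_E_4, LFunction_E_11]
  norm_num

/-- `a_45(5077a) = -24` (`45 = 9·5`, multiplicativity). [cite: CremonaAlgorithms1997, Table 3 (5077a)] -/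
theorem LFunction_E_45 : E.LFunction 45 = -24 := by
  rw [show (45 : ℕ) = 9 * 5 by norm_num,
    E.isMultiplicative_LFunction.map_mul_of_coprime (by norm_num), LFunction_E_9, LFunction_E_5]
  norm_num

/-- `a_46(5077a) = 12` (`46 = 2·23`, multiplicativity). [cite: CremonaAlgorithms1997, Table 3 (5077a)] -/
theorem LFunction_E_46 : E.LFunction 46 = 12 := by
  rw [show (46 : ℕ) = 2 * 23 by norm_num,
    E.isMultiplicative_LFunction.map_mul_of_coprime (by norm_num), LFunction_E_2, LFunction_E_23]
  norm_num

/-- `a_48(5077a) = 12` (`48 = 16·3`, multiplicativity). [cite: CremonaAlgorithms1997, Table 3 (5077a)] -/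
theorem LFunction_E_48 : E.LFunction 48 = 12 := by
  rw [show (48 : ℕ) = 16 * 3 by norm_num,
    E.isMultiplicative_LFunction.map_mul_of_coprime (by norm_num), LFunction_E_16, LFunction_E_3]
  norm_num

/-- `a_49(5077a) = 9` (`49 = 7^2`, `a_{p^(k+2)} = a_p a_{p^(k+1)} − p a_{p^k}`). [cite: CremonaAlgorithms1997, Table 3 (5077a)] -/
theorem LFunction_E_49 : E.LFunction 49 = 9 := by
  rw [show (49 : ℕ) = 7 ^ (0 + 2) by norm_num,
    E.LFunction_apply_prime_pow_add_two_of_prime (by norm_num : Nat.Prime 7) 0, conductorNorm_E,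
    show (7 : ℕ) ^ (0 + 1) = 7 by norm_num, show (7 : ℕ) ^ 0 = 1 by norm_num]
  simp only [LFunction_E_7, LFunction_E_7, LFunction_E_1]
  norm_num

/-- `a_50(5077a) = -22` (`50 = 2·25`, multiplicativity). [cite: CremonaAlgorithms1997, Table 3 (5077a)] -/
theorem LFunction_E_50 : E.LFunction 50 = -22 := by
  rw [show (50 : ℕ) = 2 * 25 by norm_num,
    E.isMultiplicative_LFunction.map_mul_of_coprime (by norm_num), LFunction_E_2, LFunction_E_25]
  norm_num

/-- `a_51(5077a) = 12` (`51 = 3·17`, multiplicativity). [cite: CremonaAlgorithms1997, Table 3 (5077a)] -/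
theorem LFunction_E_51 : E.LFunction 51 = 12 := by
  rw [show (51 : ℕ) = 3 * 17 by norm_num,
    E.isMultiplicative_LFunction.map_mul_of_coprime (by norm_num), LFunction_E_3, LFunction_E_17]
  norm_num

/-- `a_52(5077a) = -8` (`52 = 4·13`, multiplicativity). [cite: CremonaAlgorithms1997, Table 3 (5077a)] -/
theorem LFunction_E_52 : E.LFunction 52 = -8 := by
  rw [show (52 : ℕ) = 4 * 13 by norm_num,
    E.isMultiplicative_LFunction.map_mul_of_coprime (by norm_num), LFunction_E_4, LFunction_E_13]
  norm_num

/-- `a_54(5077a) = 18` (`54 = 2·27`, multiplicativity). [cite: CremonaAlgorithms1997, Table 3 (5077a)] -/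
theorem LFunction_E_54 : E.LFunction 54 = 18 := by
  rw [show (54 : ℕ) = 2 * 27 by norm_num,
    E.isMultiplicative_LFunction.map_mul_of_coprime (by norm_num), LFunction_E_2, LFunction_E_27]
  norm_num

/-- `a_55(5077a) = 24` (`55 = 5·11`, multiplicativity). [cite: CremonaAlgorithms1997, Table 3 (5077a)] -/
theorem LFunction_E_55 : E.LFunction 55 = 24 := by
  rw [show (55 : ℕ) = 5 * 11 by norm_num,
    E.isMultiplicative_LFunction.map_mul_of_coprime (by norm_num), LFunction_E_5, LFunction_E_11]
  norm_num

/-- `a_56(5077a) = 0` (`56 = 8·7`, multiplicativity). [cite: CremonaAlgorithms1997, Table 3 (5077a)] -/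
theorem LFunction_E_56 : E.LFunction 56 = 0 := by
  rw [show (56 : ℕ) = 8 * 7 by norm_num,
    E.isMultiplicative_LFunction.map_mul_of_coprime (by norm_num), LFunction_E_8, LFunction_E_7]
  norm_num

/-- `a_57(5077a) = 21` (`57 = 3·19`, multiplicativity). [cite: CremonaAlgorithms1997, Table 3 (5077a)] -/
theorem LFunction_E_57 : E.LFunction 57 = 21 := by
  rw [show (57 : ℕ) = 3 * 19 by norm_num,
    E.isMultiplicative_LFunction.map_mul_of_coprime (by norm_num), LFunction_E_3, LFunction_E_19]
  norm_num

/-- `a_58(5077a) = 12` (`58 = 2·29`, multiplicativity). [cite: CremonaAlgorithms1997, Table 3 (5077a)] -/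
theorem LFunction_E_58 : E.LFunction 58 = 12 := by
  rw [show (58 : ℕ) = 2 * 29 by norm_num,
    E.isMultiplicative_LFunction.map_mul_of_coprime (by norm_num), LFunction_E_2, LFunction_E_29]
  norm_num

/-- `a_60(5077a) = 24` (`60 = 4·15`, multiplicativity). [cite: CremonaAlgorithms1997, Table 3 (5077a)] -/
theorem LFunction_E_60 : E.LFunction 60 = 24 := by
  rw [show (60 : ℕ) = 4 * 15 by norm_num,
    E.isMultiplicative_LFunction.map_mul_of_coprime (by norm_num), LFunction_E_4, LFunction_E_15]
  norm_num

/-- `a_62(5077a) = 4` (`62 = 2·31`, multiplicativity). [cite: CremonaAlgorithms1997, Table 3 (5077a)] -/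
theorem LFunction_E_62 : E.LFunction 62 = 4 := by
  rw [show (62 : ℕ) = 2 * 31 by norm_num,
    E.isMultiplicative_LFunction.map_mul_of_coprime (by norm_num), LFunction_E_2, LFunction_E_31]
  norm_num

/-- `a_63(5077a) = -24` (`63 = 9·7`, multiplicativity). [cite: CremonaAlgorithms1997, Table 3 (5077a)] -/
theorem LFunction_E_63 : E.LFunction 63 = -24 := by
  rw [show (63 : ℕ) = 9 * 7 by norm_num,
    E.isMultiplicative_LFunction.map_mul_of_coprime (by norm_num), LFunction_E_9, LFunction_E_7]
  norm_num

/-- `a_64(5077a) = -8` (`64 = 2^6`, `a_{p^(k+2)} = a_p a_{p^(k+1)} − p a_{p^k}`). [cite: CremonaAlgorithms1997, Table 3 (5077a)] -/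
theorem LFunction_E_64 : E.LFunction 64 = -8 := by
  rw [show (64 : ℕ) = 2 ^ (4 + 2) by norm_num,
    E.LFunction_apply_prime_pow_add_two_of_prime (by norm_num : Nat.Prime 2) 4, conductorNorm_E,
    show (2 : ℕ) ^ (4 + 1) = 32 by norm_num, show (2 : ℕ) ^ 4 = 16 by norm_num]
  simp only [LFunction_E_2, LFunction_E_32, LFunction_E_16]
  norm_num

end Literature.NumberTheory.EllipticCurves.Curve5077a
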